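import Literature.Topology.FourManifolds.NonSeparatingSpheresThickening
import Literature.Topology.FourManifolds.NonSeparatingSpheresNormalField
import Literature.Topology.FourManifolds.NonSeparatingSpheresInflation
import Literature.Topology.FourManifolds.NonSeparatingSpheresDrill
import HarnessLib

/-!
# Budney–Gabai Thm. 3.13 for `n ≥ 3` (Cerf–Palais step, V: descent to `S¹ × Sⁿ` and assembly)

Fact seat of `Literature.Topology.FourManifolds.BudneyGabai2019_thm_3_13` (`NonSeparatingSpheres.lean`;
R. Budney, D. Gabai, *Knotted 3-balls in `S⁴`*, arXiv:1912.09029 (v2), Thm. 3.13: *"The group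
`Diff(S¹ × Sⁿ)` acts transitively on the non-separating `n`-spheres in `S¹ × Sⁿ`."*  Proof, p. 22:
*"When `n ≥ 3` observe that complementary to a non-separating sphere there is an embedding
`S¹ → S¹ × Sⁿ` that intersects the sphere precisely once and transversely. Since
`dim(S¹ × Sⁿ) ≥ 4`, we can isotope our embedding to be equal to `S¹ × {*}` and similarly isotope
our non-separating sphere. If we drill a neighbourhood of `S¹ × {*}` out of `S¹ × Sⁿ` we have
constructed `S¹ × Bⁿ`, and our non-separating sphere is converted to a reducing ball. The result
follows from Theorem 3.12."*).  This file completes the formalization of that proof: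

* `Surgery.exists_diffeomorph_descend` — a diffeomorphism of `Sⁿ⁺¹` which is the identity near the
  great sphere `S_L = {z = 0}` descends along the surgery map `Θ`
  (`NonSeparatingSpheresSurgeryModel.lean`) to a diffeomorphism of `S¹ × Sⁿ` (`Θ⁻¹ ∘ F ∘ Θ` over
  `{p₀ > 0}`, the identity over `{p₀ < η}`; a tube `{‖z‖ < η}` lies in the fixed neighbourhood by
  compactness, `exists_tube_subset`);
* `Surgery.exists_diffeomorph_image_eq_of_flat_below` — **a sphere flat below the latitude
  `255/257` is standard**: surgery disc (`exists_surgeryDisc_twelve`), unit normal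
  (`exists_unitNormal`), Cerf–Palais step in `Sⁿ⁺¹` (`exists_diffeomorph_cerfPalais`), descent;
* `exists_image_eq_range_standardSphere_of_flat_tube` — **Budney–Gabai Thm. 3.12 read in `S¹ × Sᵏ`
  (all `k ≥ 1`)**: a non-separating sphere flat over a tube `S¹ × B̄(p₀, r)` is carried onto
  `{1} × Sᵏ` by a diffeomorphism (inflate the tube, `exists_diffeomorph_flat_below`, then the
  previous item) — the hypothesis `Hred` of `exists_image_eq_range_standardSphere_of_reducingBall`
  (`NonSeparatingSpheresDrill.lean`), now discharged;
* **`exists_image_eq_range_standardSphere_of_three_le`**, **`budneyGabai_thm_3_13_of_three_le`** —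
  **Thm. 3.13 for `n ≥ 3`** (standard-target form and transitivity form), by the printed proof:
  dual circle (`EmbeddedSubmanifoldDualCircle.lean`), degree `±1` (`NonSeparatingSpheresDegree.lean`),
  standardisation of the circle by Whitney's theorem and isotopy extension
  (`NonSeparatingSpheresStandardizeCircle.lean`), drilling (`NonSeparatingSpheresDrill.lean`), and
  Thm. 3.12 via the Cerf–Palais disc theorem (this file).

The cases `n = 1, 2` of the named fact ("classical" in the source: curves on the torus; Alexander's
theorem in `S³`) are not treated here.  Everything in this file is proved; no definitions and no
named facts are introduced.

## References

* R. Budney, D. Gabai, *Knotted 3-balls in `S⁴`*, arXiv:1912.09029 (v2), §3, Thm. 3.12, the remark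
  following it, Thm. 3.13 and its proof (p. 22). [BudneyGabai2019]
* M. W. Hirsch, *Differential Topology*, GTM 33 (1976), Ch. 8 §3, Thm. 3.1. [HirschDT1976]
* R. Palais, *Extending diffeomorphisms*, Proc. AMS 11 (1960), Thm. B; J. Cerf (1961). [Palais1960]
-/

noncomputable section

open scoped Manifold ContDiff Topology Real RealInnerProductSpace
open Set Function Metric Module

/-- Local notation: Euclidean model space. -/
local notation "𝔼 " n:arg => EuclideanSpace ℝ (Fin n)
/-- Local notation: the unit sphere `Sⁿ ⊆ ℝⁿ⁺¹`. -/
local notation "𝕊 " n:arg => (Metric.sphere (0 : EuclideanSpace ℝ (Fin (n + 1))) 1)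

namespace Literature.Topology.FourManifolds

namespace BudneyGabai2019_thm_3_13

namespace Surgery

attribute [local instance] fact_finrank_euclideanSpace_succ
attribute [local instance] finrank_real_complex_fact'

variable {n : ℕ}

/-! ### Descent of a diffeomorphism of `Sⁿ⁺¹` fixing a neighbourhood of `S_L` to `S¹ × Sⁿ` -/

/-- A neighbourhood of the great sphere `S_L = {z = 0}` contains a tube `{‖z‖ < η}` (compactness).
[folklore] -/
theorem exists_tube_subset {W : Set (𝕊 (n + 1))} (hW : IsOpen W)
    (hWSL : {v : 𝕊 (n + 1) | zc n (v : 𝔼 (n + 1 + 1)) = 0} ⊆ W) :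
    ∃ η > 0, ∀ v : 𝕊 (n + 1), ‖zc n (v : 𝔼 (n + 1 + 1))‖ < η → v ∈ W := by
  have hg : Continuous fun v : 𝕊 (n + 1) ↦ ‖zc n (v : 𝔼 (n + 1 + 1))‖ :=
    continuous_norm.comp ((contDiff_zc n).continuous.comp continuous_subtype_val)
  have hC : IsCompact Wᶜ := hW.isClosed_compl.isCompact
  rcases (Wᶜ).eq_empty_or_nonempty with hempty | hne
  · refine ⟨1, one_pos, fun v _ ↦ ?_⟩
    by_contra hv
    have : v ∈ Wᶜ := hv
    rw [hempty] at this
    exact this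
  · obtain ⟨v₀, hv₀, hmin⟩ := hC.exists_isMinOn hne hg.continuousOn
    have hpos : 0 < ‖zc n (v₀ : 𝔼 (n + 1 + 1))‖ := by
      rw [norm_pos_iff]
      intro h0
      exact hv₀ (hWSL h0)
    refine ⟨‖zc n (v₀ : 𝔼 (n + 1 + 1))‖, hpos, fun v hv ↦ ?_⟩
    by_contra hvW
    exact absurd ((isMinOn_iff.1 hmin) v hvW) (not_le.2 hv)

/-- A diffeomorphism of `Sⁿ⁺¹` which is the identity on a set containing `S_L = {z = 0}`
preserves the complement `{z ≠ 0}`. [folklore] -/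
theorem zc_ne_zero_of_apply {F : (𝕊 (n + 1)) ≃ₘ⟮𝓡 (n + 1), 𝓡 (n + 1)⟯ (𝕊 (n + 1))}
    {W : Set (𝕊 (n + 1))} (hWSL : {v : 𝕊 (n + 1) | zc n (v : 𝔼 (n + 1 + 1)) = 0} ⊆ W)
    (hFW : ∀ w ∈ W, F w = w) {v : 𝕊 (n + 1)} (hv : zc n (v : 𝔼 (n + 1 + 1)) ≠ 0) :
    zc n (F v : 𝔼 (n + 1 + 1)) ≠ 0 := by
  intro h0
  have h1 : F (F v) = F v := hFW _ (hWSL h0)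
  have h2 : F v = v := (EquivLike.injective F) h1
  rw [h2] at h0
  exact hv h0

/-- **Descent.**  A diffeomorphism `F` of `Sⁿ⁺¹` which is the identity on a neighbourhood `W` of
the great sphere `S_L = {z = 0}` descends along the surgery map `Θ` to a diffeomorphism `Φ` of
`S¹ × Sⁿ`: `Φ = Θ⁻¹ ∘ F ∘ Θ` over the open solid torus `{p₀ > 0}` and `Φ = id` over `{p₀ < η}`
(where `Θ` lands in `W`).  (The inverse of "attach `Sⁿ⁻¹ × D²` to obtain `Sⁿ⁺¹`" in
Budney–Gabai's remark after Thm. 3.12: a diffeomorphism of the sphere fixing a neighbourhood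
of the attached `Sⁿ⁻¹` restricts to `S¹ × Bⁿ` and extends by the identity.) [folklore] -/
theorem exists_diffeomorph_descend (F : (𝕊 (n + 1)) ≃ₘ⟮𝓡 (n + 1), 𝓡 (n + 1)⟯ (𝕊 (n + 1)))
    {W : Set (𝕊 (n + 1))} (hW : IsOpen W)
    (hWSL : {v : 𝕊 (n + 1) | zc n (v : 𝔼 (n + 1 + 1)) = 0} ⊆ W) (hFW : ∀ w ∈ W, F w = w) :
    ∃ Φ : (Circle × 𝕊 n) ≃ₘ⟮(𝓡 1).prod (𝓡 n), (𝓡 1).prod (𝓡 n)⟯ (Circle × 𝕊 n),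
      (∀ q : Circle × 𝕊 n, 0 < (q.2 : 𝔼 (n + 1)) 0 → Φ q = inv n (F (map n q))) ∧
      (∀ q : Circle × 𝕊 n, (q.2 : 𝔼 (n + 1)) 0 ≤ 0 → Φ q = q) := by
  obtain ⟨η, hη, hηW⟩ := exists_tube_subset hW hWSL
  have hFW' : ∀ w ∈ W, F.symm w = w := fun w hw ↦ by
    conv_lhs => rw [← hFW w hw]
    exact F.symm_apply_apply w
  -- the two formulas and their overlap
  have key : ∀ (G : (𝕊 (n + 1)) ≃ₘ⟮𝓡 (n + 1), 𝓡 (n + 1)⟯ (𝕊 (n + 1))), (∀ w ∈ W, G w = w) →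
      ∀ q : Circle × 𝕊 n, 0 < (q.2 : 𝔼 (n + 1)) 0 → (q.2 : 𝔼 (n + 1)) 0 < η →
        inv n (G (map n q)) = q := by
    intro G hGW q hq hqη
    have hmem : map n q ∈ W := hηW _ (by rw [norm_zc_coe_map, abs_of_pos hq]; exact hqη)
    rw [hGW _ hmem, inv_map n hq]
  -- the descended maps
  set Φf : ((𝕊 (n + 1)) ≃ₘ⟮𝓡 (n + 1), 𝓡 (n + 1)⟯ (𝕊 (n + 1))) → (Circle × 𝕊 n) → Circle × 𝕊 n :=
    fun G q ↦ if (q.2 : 𝔼 (n + 1)) 0 < η then q else inv n (G (map n q)) with hΦf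
  have hpos : ∀ (G : (𝕊 (n + 1)) ≃ₘ⟮𝓡 (n + 1), 𝓡 (n + 1)⟯ (𝕊 (n + 1))), (∀ w ∈ W, G w = w) →
      ∀ q : Circle × 𝕊 n, 0 < (q.2 : 𝔼 (n + 1)) 0 → Φf G q = inv n (G (map n q)) := by
    intro G hGW q hq
    simp only [hΦf]
    split_ifs with h
    · exact (key G hGW q hq h).symm
    · rfl
  have hsmall : ∀ (G : (𝕊 (n + 1)) ≃ₘ⟮𝓡 (n + 1), 𝓡 (n + 1)⟯ (𝕊 (n + 1))) (q : Circle × 𝕊 n),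
      (q.2 : 𝔼 (n + 1)) 0 < η → Φf G q = q := by
    intro G q hq
    simp only [hΦf, if_pos hq]
  -- smoothness
  have hcont0 : Continuous fun q : Circle × 𝕊 n ↦ (q.2 : 𝔼 (n + 1)) 0 :=
    (EuclideanSpace.proj (0 : Fin (n + 1))).continuous.comp (continuous_subtype_val.comp continuous_snd)
  have hsmooth : ∀ (G : (𝕊 (n + 1)) ≃ₘ⟮𝓡 (n + 1), 𝓡 (n + 1)⟯ (𝕊 (n + 1))), (∀ w ∈ W, G w = w) →
      ContMDiff ((𝓡 1).prod (𝓡 n)) ((𝓡 1).prod (𝓡 n)) ∞ (Φf G) := by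
    intro G hGW q
    by_cases hq : 0 < (q.2 : 𝔼 (n + 1)) 0
    · -- over the open solid torus: `Θ⁻¹ ∘ G ∘ Θ`
      have hev : Φf G =ᶠ[𝓝 q] fun q ↦ inv n (G (map n q)) :=
        Filter.eventually_of_mem ((isOpen_setOf_pos n).mem_nhds hq) fun q' hq' ↦ hpos G hGW q' hq'
      refine ContMDiffAt.congr_of_eventuallyEq ?_ hev
      have hz : zc n (G (map n q) : 𝔼 (n + 1 + 1)) ≠ 0 :=
        zc_ne_zero_of_apply hWSL hGW ((zc_coe_map_ne_zero_iff n q).2 hq.ne')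
      have hinv : ContMDiffAt (𝓡 (n + 1)) ((𝓡 1).prod (𝓡 n)) ∞ (inv n) (G (map n q)) :=
        (contMDiffOn_inv n).contMDiffAt ((isOpen_setOf_zc_ne n).mem_nhds hz)
      exact hinv.comp q (G.contMDiff.contMDiffAt.comp q (contMDiff_map n q))
    · -- near the complement: the identity
      push Not at hq
      have hev : Φf G =ᶠ[𝓝 q] id :=
        Filter.eventually_of_mem ((isOpen_lt hcont0 continuous_const).mem_nhds (hq.trans_lt hη))
          fun q' hq' ↦ hsmall G q' hq'
      exact contMDiffAt_id.congr_of_eventuallyEq hev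
  -- the two maps are inverse to each other
  have hinvol : ∀ (G : (𝕊 (n + 1)) ≃ₘ⟮𝓡 (n + 1), 𝓡 (n + 1)⟯ (𝕊 (n + 1))), (∀ w ∈ W, G w = w) →
      (∀ w ∈ W, G.symm w = w) → ∀ q, Φf G (Φf G.symm q) = q := by
    intro G hGW hGW' q
    by_cases hq : (q.2 : 𝔼 (n + 1)) 0 < η
    · rw [hsmall G.symm q hq, hsmall G q hq]
    · push Not at hq
      have hq0 : 0 < (q.2 : 𝔼 (n + 1)) 0 := hη.trans_le hq
      have hz : zc n (map n q : 𝔼 (n + 1 + 1)) ≠ 0 := (zc_coe_map_ne_zero_iff n q).2 hq0.ne'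
      have hz' : zc n (G.symm (map n q) : 𝔼 (n + 1 + 1)) ≠ 0 := zc_ne_zero_of_apply hWSL hGW' hz
      set q' := inv n (G.symm (map n q)) with hq'
      have hq'0 : 0 < (q'.2 : 𝔼 (n + 1)) 0 := by
        rw [hq', coe_inv_snd_apply_zero]; exact norm_pos_iff.2 hz'
      rw [hpos G.symm hGW' q hq0, hpos G hGW q' hq'0, hq', map_inv n hz', G.apply_symm_apply,
        inv_map n hq0]
  let Φ : (Circle × 𝕊 n) ≃ₘ⟮(𝓡 1).prod (𝓡 n), (𝓡 1).prod (𝓡 n)⟯ (Circle × 𝕊 n) :=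
    { toFun := Φf F
      invFun := Φf F.symm
      left_inv := fun q ↦ by
        have h := hinvol F.symm hFW' (by intro w hw; exact hFW w hw) q
        exact h
      right_inv := hinvol F hFW hFW'
      contMDiff_toFun := hsmooth F hFW
      contMDiff_invFun := hsmooth F.symm hFW' }
  refine ⟨Φ, fun q hq ↦ hpos F hFW q hq, fun q hq ↦ hsmall F q (hq.trans_lt hη)⟩

/-! ### From the Cerf–Palais step to the standard sphere -/

/-- **A flat non-separating sphere is standard** (the `Hred` of `NonSeparatingSpheresDrill.lean`,
in the normalised form "flat below the latitude `255/257`"): composition of the surgery disc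
(`exists_surgeryDisc_twelve`), its unit normal field (`exists_unitNormal`), the Cerf–Palais step
in `Sⁿ⁺¹` (`exists_diffeomorph_cerfPalais`) and the descent (`exists_diffeomorph_descend`).
[cite: BudneyGabai2019, Thm. 3.12, remark, and proof of Thm. 3.13 (arXiv:1912.09029 v2, p. 22)] -/
theorem exists_diffeomorph_image_eq_of_flat_below {f : 𝕊 n → Circle × 𝕊 n}
    (hf : Manifold.IsSmoothEmbedding (𝓡 n) ((𝓡 1).prod (𝓡 n)) ∞ f)
    (hflat : range f ∩ {q | (q.2 : 𝔼 (n + 1)) 0 ≤ 255 / 257} =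
      ({1} : Set Circle) ×ˢ {p : 𝕊 n | (p : 𝔼 (n + 1)) 0 ≤ 255 / 257}) :
    ∃ Φ : (Circle × 𝕊 n) ≃ₘ⟮(𝓡 1).prod (𝓡 n), (𝓡 1).prod (𝓡 n)⟯ (Circle × 𝕊 n),
      Φ '' range f = ({1} : Set Circle) ×ˢ univ := by
  have hℓ : (255 : ℝ) / 257 ≤ 255 / 257 := le_rfl
  obtain ⟨φ, hφ, hφimm, hφinj, hφstd, hφimage⟩ := exists_surgeryDisc_twelve hf hℓ hflat
  obtain ⟨ν, hν, hν1, hνφ, hνd, hνstd⟩ := exists_unitNormal hφ hφimm (contMDiff_stdDisc n)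
    (mfderiv_stdDisc_injective n) (coe_stdDisc_apply_one n)
    (isOpen_lt continuous_const continuous_norm) fun y hy ↦ hφstd y (le_of_lt hy)
  obtain ⟨F, W, hW, hWSL, hFW, hFimage⟩ :=
    exists_diffeomorph_cerfPalais hφ hφimm hφinj hφstd hν hν1 hνφ hνd hνstd
  obtain ⟨Φ, hΦpos, hΦneg⟩ := exists_diffeomorph_descend (n := n) F hW hWSL hFW
  refine ⟨Φ, ?_⟩
  -- `F` carries `Δ₁ = Θ(K ∩ {p₀ > 0}) ∪ S_L` onto `H̄₊`
  have hΔ : F '' (map n '' (range f ∩ {q | 0 < (q.2 : 𝔼 (n + 1)) 0}) ∪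
      {v : 𝕊 (n + 1) | zc n (v : 𝔼 (n + 1 + 1)) = 0}) =
      {v : 𝕊 (n + 1) | (v : 𝔼 (n + 1 + 1)) 1 = 0 ∧ 0 ≤ (v : 𝔼 (n + 1 + 1)) 0} := by
    rw [← hφimage, hFimage, image_stdDisc_closedBall]
  have hfi : Injective f := hf.isEmbedding.injective
  apply Subset.antisymm
  · rintro _ ⟨q, hq, rfl⟩
    by_cases hq0 : 0 < (q.2 : 𝔼 (n + 1)) 0
    · -- over the open solid torus
      rw [hΦpos q hq0]
      have hmem : F (map n q) ∈ {v : 𝕊 (n + 1) | (v : 𝔼 (n + 1 + 1)) 1 = 0 ∧ 0 ≤ (v : 𝔼 (n + 1 + 1)) 0} := by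
        rw [← hΔ]; exact mem_image_of_mem F (Or.inl ⟨q, ⟨hq, hq0⟩, rfl⟩)
      obtain ⟨h1, h0⟩ := hmem
      have hz : zc n (F (map n q) : 𝔼 (n + 1 + 1)) ≠ 0 :=
        zc_ne_zero_of_apply hWSL hFW ((zc_coe_map_ne_zero_iff n q).2 hq0.ne')
      have h0' : 0 < (F (map n q) : 𝔼 (n + 1 + 1)) 0 := by
        rcases h0.eq_or_lt with h | h
        · exfalso; apply hz
          apply Complex.ext
          · simpa using h.symm
          · simpa using h1
        · exact h
      -- `F (Θ q) = ι_E p` with `p₀ > 0`, so `Θ⁻¹` of it is `(1, p)`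
      obtain ⟨p, hp⟩ : F (map n q) ∈ range (equator n) := by rw [range_equator]; exact h1
      have hp0 : 0 < (p : 𝔼 (n + 1)) 0 := by rwa [← hp, coe_equator_apply_zero] at h0'
      rw [← hp, ← map_one, inv_map n hp0]
      exact ⟨rfl, mem_univ _⟩
    · push Not at hq0
      rw [hΦneg q hq0]
      exact ⟨fst_eq_one_of_flat hflat hq (hq0.trans (by norm_num)), mem_univ _⟩
  · rintro ⟨u, p⟩ ⟨hu, -⟩
    rw [mem_singleton_iff] at hu
    subst hu
    by_cases hp0 : 0 < (p : 𝔼 (n + 1)) 0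
    · have hmem : equator n p ∈ {v : 𝕊 (n + 1) | (v : 𝔼 (n + 1 + 1)) 1 = 0 ∧ 0 ≤ (v : 𝔼 (n + 1 + 1)) 0} :=
        ⟨coe_equator_apply_one n p, by rw [coe_equator_apply_zero]; exact hp0.le⟩
      rw [← hΔ] at hmem
      obtain ⟨w, hw, hwp⟩ := hmem
      rcases hw with ⟨q, ⟨hq, hq0⟩, rfl⟩ | hw
      · refine ⟨q, hq, ?_⟩
        rw [hΦpos q hq0, hwp, ← map_one, inv_map n hp0]
      · exfalso
        have h1 : F w = w := hFW w (hWSL hw)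
        rw [h1] at hwp
        have h2 : zc n (equator n p : 𝔼 (n + 1 + 1)) = 0 := by rw [← hwp]; exact hw
        have h3 : (p : 𝔼 (n + 1)) 0 = 0 := by
          have := congrArg Complex.re h2
          simpa [equator, zc_coe_map] using this
        linarith
    · push Not at hp0
      refine ⟨((1 : Circle), p), mem_range_of_flat hflat (hp0.trans (by norm_num)), ?_⟩
      exact hΦneg _ hp0

end Surgery

/-! ### Budney–Gabai Thm. 3.13 for `n ≥ 3` -/

/-- **Reducing balls are standard** — the hypothesis `Hred` of
`exists_image_eq_range_standardSphere_of_reducingBall` (Budney–Gabai Thm. 3.12 read in `S¹ × Sⁿ`),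
for every `k ≥ 1`: a smoothly embedded non-separating `k`-sphere of `S¹ × Sᵏ` which meets a closed
tube `S¹ × B̄(p₀, r)` exactly in the flat disc `{1} × B̄(p₀, r)` is carried onto `{1} × Sᵏ` by a
diffeomorphism.  Proof: inflate the flat tube to `S¹ × {p₀ ≤ 255/257}`
(`exists_diffeomorph_flat_below`, disc theorem in `Sᵏ`), then `exists_diffeomorph_image_eq_of_flat_below`
(attach `Sᵏ⁻¹ × D²`, Cerf–Palais disc theorem in `Sᵏ⁺¹`, descend) — the source's alternative
proof of its Thm. 3.12 (remark after Thm. 3.12, arXiv:1912.09029 v2, p. 22).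
[cite: BudneyGabai2019, Thm. 3.12 and remark (arXiv:1912.09029 v2, p. 22); HirschDT1976, Ch. 8 §3 Thm. 3.1] -/
theorem exists_image_eq_range_standardSphere_of_flat_tube {k : ℕ} (hk : 1 ≤ k)
    (f : Metric.sphere (0 : EuclideanSpace ℝ (Fin (k + 1))) 1 →
      Circle × Metric.sphere (0 : EuclideanSpace ℝ (Fin (k + 1))) 1)
    (p₀ : Metric.sphere (0 : EuclideanSpace ℝ (Fin (k + 1))) 1) (r : ℝ) (hr : 0 < r)
    (hf : Manifold.IsSmoothEmbedding (𝓡 k) ((𝓡 1).prod (𝓡 k)) ∞ f) (hconn : IsConnected (range f)ᶜ)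
    (hflat : range f ∩ {q | q.2 ∈ closedBall p₀ r} = ({1} : Set Circle) ×ˢ closedBall p₀ r) :
    ∃ Φ : (Circle × Metric.sphere (0 : EuclideanSpace ℝ (Fin (k + 1))) 1) ≃ₘ⟮(𝓡 1).prod (𝓡 k),
        (𝓡 1).prod (𝓡 k)⟯ (Circle × Metric.sphere (0 : EuclideanSpace ℝ (Fin (k + 1))) 1),
      Φ '' range f = range (standardSphere k) := by
  obtain ⟨Ψ, hΨf, -, hΨflat⟩ := exists_diffeomorph_flat_below hk hf hconn p₀ hr hflat
    (ℓ := 255 / 257) (by norm_num) (by norm_num)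
  obtain ⟨Φ, hΦ⟩ := Surgery.exists_diffeomorph_image_eq_of_flat_below hΨf hΨflat
  refine ⟨Ψ.trans Φ, ?_⟩
  rw [Diffeomorph.coe_trans, image_comp, ← range_comp, hΦ, range_standardSphere]

/-- **Budney–Gabai Thm. 3.13 for `n ≥ 3`, standard-target form**: every smoothly embedded
non-separating `n`-sphere of `S¹ × Sⁿ`, `n ≥ 3`, is carried onto the standard sphere `{1} × Sⁿ` by
a diffeomorphism of `S¹ × Sⁿ`.  The printed proof, formalized end to end: dual circle of degree
`±1` (`NonSeparatingSpheresDegree.lean`), isotoped onto `S¹ × {*}` by Whitney's theorem and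
isotopy extension (`NonSeparatingSpheresStandardizeCircle.lean`), drilling / flattening over a
tube (`NonSeparatingSpheresDrill.lean`), and Thm. 3.12 by the Cerf–Palais disc theorem
(`exists_image_eq_range_standardSphere_of_flat_tube`).
[cite: BudneyGabai2019, Thm. 3.13 (arXiv:1912.09029 v2, p. 22)] -/
theorem exists_image_eq_range_standardSphere_of_three_le {n : ℕ} (hn : 3 ≤ n)
    (e : Metric.sphere (0 : EuclideanSpace ℝ (Fin (n + 1))) 1 →
      Circle × Metric.sphere (0 : EuclideanSpace ℝ (Fin (n + 1))) 1)
    (he : Manifold.IsSmoothEmbedding (𝓡 n) ((𝓡 1).prod (𝓡 n)) ∞ e)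
    (hconn : IsConnected (range e)ᶜ) :
    ∃ Φ : (Circle × Metric.sphere (0 : EuclideanSpace ℝ (Fin (n + 1))) 1) ≃ₘ⟮(𝓡 1).prod (𝓡 n),
        (𝓡 1).prod (𝓡 n)⟯ (Circle × Metric.sphere (0 : EuclideanSpace ℝ (Fin (n + 1))) 1),
      Φ '' range e = range (standardSphere n) :=
  exists_image_eq_range_standardSphere_of_reducingBall
    (fun k hk f p₀ r hr hf hconn hflat ↦
      exists_image_eq_range_standardSphere_of_flat_tube (by omega) f p₀ r hr hf hconn hflat)
    hn e he hconn

/-- **Budney–Gabai Thm. 3.13 for `n ≥ 3`** (transitivity form of the named fact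
`BudneyGabai2019_thm_3_13`, restricted to `n ≥ 3`): `Diff(S¹ × Sⁿ)` acts transitively on the
smoothly embedded non-separating `n`-spheres of `S¹ × Sⁿ`.  (The cases `n = 1, 2` of the named fact
are the classical ones — curves on the torus, Alexander's theorem in `S³` — and are not covered
here.) [cite: BudneyGabai2019, Thm. 3.13 (arXiv:1912.09029 v2, p. 22)] -/
theorem budneyGabai_thm_3_13_of_three_le {n : ℕ} (hn : 3 ≤ n)
    (e₁ e₂ : Metric.sphere (0 : EuclideanSpace ℝ (Fin (n + 1))) 1 →
      Circle × Metric.sphere (0 : EuclideanSpace ℝ (Fin (n + 1))) 1)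
    (he₁ : Manifold.IsSmoothEmbedding (𝓡 n) ((𝓡 1).prod (𝓡 n)) ∞ e₁) (hconn₁ : IsConnected (range e₁)ᶜ)
    (he₂ : Manifold.IsSmoothEmbedding (𝓡 n) ((𝓡 1).prod (𝓡 n)) ∞ e₂) (hconn₂ : IsConnected (range e₂)ᶜ) :
    ∃ Φ : (Circle × Metric.sphere (0 : EuclideanSpace ℝ (Fin (n + 1))) 1) ≃ₘ⟮(𝓡 1).prod (𝓡 n),
        (𝓡 1).prod (𝓡 n)⟯ (Circle × Metric.sphere (0 : EuclideanSpace ℝ (Fin (n + 1))) 1),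
      Φ '' range e₁ = range e₂ := by
  obtain ⟨Φ₁, h₁⟩ := exists_image_eq_range_standardSphere_of_three_le hn e₁ he₁ hconn₁
  obtain ⟨Φ₂, h₂⟩ := exists_image_eq_range_standardSphere_of_three_le hn e₂ he₂ hconn₂
  refine ⟨Φ₁.trans Φ₂.symm, ?_⟩
  rw [Diffeomorph.coe_trans, image_comp, h₁, ← h₂, Diffeomorph.symm_image_image]


/-! ### Unconditional corollaries in the shapes used downstream -/

/-- **The case `n = 3`, unconditionally** (shape of the route item `NonSepSphereTransitive`,
`SmoothPoincare4/CircularKirby`; cf. the conditional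
`BudneyGabai2019_thm_3_13.exists_image_eq_range_standardSphere_three`): a smoothly embedded
non-separating `3`-sphere in `S¹ × S³` is carried onto `{1} × S³` by a diffeomorphism of `S¹ × S³`.
[cite: BudneyGabai2019, Thm. 3.13 (arXiv:1912.09029 v2, p. 22)] -/
theorem exists_image_eq_range_standardSphere_three'
    (e : Metric.sphere (0 : EuclideanSpace ℝ (Fin 4)) 1 →
      Circle × Metric.sphere (0 : EuclideanSpace ℝ (Fin 4)) 1)
    (he : Manifold.IsSmoothEmbedding (𝓡 3) ((𝓡 1).prod (𝓡 3)) ∞ e)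
    (hconn : IsConnected (range e)ᶜ) :
    ∃ Φ : (Circle × Metric.sphere (0 : EuclideanSpace ℝ (Fin 4)) 1) ≃ₘ⟮(𝓡 1).prod (𝓡 3),
        (𝓡 1).prod (𝓡 3)⟯ (Circle × Metric.sphere (0 : EuclideanSpace ℝ (Fin 4)) 1),
      Φ '' range e = range fun p ↦ ((1 : Circle), p) :=
  exists_image_eq_range_standardSphere_of_three_le (n := 3) le_rfl e he hconn

/-- **The "moreover" of Thm. 3.13 for `n ≥ 3`, unconditionally**: every smoothly embedded
non-separating `n`-sphere of `S¹ × Sⁿ`, `n ≥ 3`, is a fibre of a smooth fibre bundle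
`S¹ × Sⁿ → S¹` — indeed of the trivial one `pr₁ ∘ Φ` for the diffeomorphism `Φ` carrying it onto
`{1} × Sⁿ` (cf. the conditional `BudneyGabai2019_thm_3_13.exists_eq_preimage_fst`).
[cite: BudneyGabai2019, Thm. 3.13 (arXiv:1912.09029 v2, p. 22)] -/
theorem exists_eq_preimage_fst_of_three_le {n : ℕ} (hn : 3 ≤ n)
    (e : Metric.sphere (0 : EuclideanSpace ℝ (Fin (n + 1))) 1 →
      Circle × Metric.sphere (0 : EuclideanSpace ℝ (Fin (n + 1))) 1)
    (he : Manifold.IsSmoothEmbedding (𝓡 n) ((𝓡 1).prod (𝓡 n)) ∞ e)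
    (hconn : IsConnected (range e)ᶜ) :
    ∃ Φ : (Circle × Metric.sphere (0 : EuclideanSpace ℝ (Fin (n + 1))) 1) ≃ₘ⟮(𝓡 1).prod (𝓡 n),
        (𝓡 1).prod (𝓡 n)⟯ (Circle × Metric.sphere (0 : EuclideanSpace ℝ (Fin (n + 1))) 1),
      range e = (Prod.fst ∘ Φ) ⁻¹' {1} := by
  obtain ⟨Φ, hΦ⟩ := exists_image_eq_range_standardSphere_of_three_le hn e he hconn
  refine ⟨Φ, ?_⟩
  have hinj : Function.Injective Φ := EquivLike.injective Φ
  rw [← hinj.preimage_image (range e), hΦ, range_standardSphere]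
  ext x
  simp

end BudneyGabai2019_thm_3_13

end Literature.Topology.FourManifolds

end
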